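import Mathlib.Tactic
import HarnessLib

/-!
# Kozma–Nitzan's Question 8 — the C-side corner condition UNI-C(U;y): reduction chain (gen 37)

Support file (`--supports stmt-CriticalPhenomena-4575`, closed crux; independent mathematics on Kozma–Nitzan's Question 8,
arXiv:2401.12397 §5.5 p. 36), prover `prim-ineq-gen-6` (gen 37).  No definitions, no named facts, no sorries; standard axioms.
Memo `run/shared/lean/prim/prim-ineq-gen-6/PROOF-UNIC-RED-G37.md`.

With UNI-A(U;y) proved for every block (THEOREM JL, …KnQuestion8JLBound.lean), the C-side corner condition UNI-C(U;y) of
FINDING-G28 §1 is the next link towards DICHOTOMY D.  At a C-hypothesis node `t` it reads `W_t = y_t/p_t + corrL_t ≥ 0`.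
THEOREM C-RED (memo) rewrites `W_t = c·γ_t(1−a_t) + Σ_v γ_{v−1}(1−C_v)A_[v,t]·Z_{v−1}` (Z-form) and bounds the deficit of the
post-region terms by an LP in the C-defects `c_v` with two shared budgets: the joint-defect budget of the last positive depth
(`Σ_v c_v·VW_v = J_{i+1} ≤ K₄/(Φ+m)`, from VIS+) and the kill budget of the hypothesis (`Σ_v c_v·KW_v ≤ N < Q₊`).  The kernels
below are the algebraic cores: `kUC_lpdual` (the LP-duality step), `kUC_varpi` (the out-defect factor ϖ against the emission
budget), `kUC_amgm` + `kUC_budget_term` (the BUDGET LEMMA `e_j·K₄ ≤ c(1−s_{j+1})Φ²θ_jM_ju_{j+1}/p_j`, sharp: it reproduces the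
supremum `3 − 2√2` of `−corrL_t/(y_t/p_t)` found in the 3-vertex family), `kUC_q2_term` (the `Q₊²/c` scale of the kill route) and
`kUC_kill` (the R-kill lower bound at a non-positive depth).  Exact link checks: lab-g37/c09_lpchain.py (0 failures).
[cite: KozmaNitzan2024, Question 8 (§5.5 p. 36)]
-/

namespace Summit.CriticalPhenomena.PercolationContinuityZ3.Theorems

namespace PocketCert

open Finset

/-- **LP-duality step.**  If the need is `Σ_{V1} c_v ω_v + Σ_{V2} c_v ω_v` with `0 ≤ c_v`, the weights satisfy `ω_v ≤ μ₁·VW_v`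
on `V1` and `ω_v ≤ μ₂·KW_v` on `V2`, and the two budgets `Σ_{V1} c_v VW_v ≤ J`, `Σ_{V2} c_v KW_v ≤ N` hold with `μ₁, μ₂ ≥ 0`,
then the need is at most `μ₁ J + μ₂ N`.
[cite: KozmaNitzan2024, Question 8 (§5.5 p. 36)] -/
theorem kUC_lpdual (V1 V2 : Finset ℕ) (cd ω VW KW : ℕ → ℝ) (μ₁ μ₂ J N : ℝ) (hμ₁ : 0 ≤ μ₁) (hμ₂ : 0 ≤ μ₂)
    (hc1 : ∀ v ∈ V1, 0 ≤ cd v) (hc2 : ∀ v ∈ V2, 0 ≤ cd v)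
    (hω1 : ∀ v ∈ V1, ω v ≤ μ₁ * VW v) (hω2 : ∀ v ∈ V2, ω v ≤ μ₂ * KW v)
    (hJ : ∑ v ∈ V1, cd v * VW v ≤ J) (hN : ∑ v ∈ V2, cd v * KW v ≤ N) :
    ∑ v ∈ V1, cd v * ω v + ∑ v ∈ V2, cd v * ω v ≤ μ₁ * J + μ₂ * N := by
  have h1 : ∑ v ∈ V1, cd v * ω v ≤ μ₁ * ∑ v ∈ V1, cd v * VW v := by
    rw [Finset.mul_sum]
    apply Finset.sum_le_sum
    intro v hv
    have := mul_le_mul_of_nonneg_left (hω1 v hv) (hc1 v hv)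
    nlinarith
  have h2 : ∑ v ∈ V2, cd v * ω v ≤ μ₂ * ∑ v ∈ V2, cd v * KW v := by
    rw [Finset.mul_sum]
    apply Finset.sum_le_sum
    intro v hv
    have := mul_le_mul_of_nonneg_left (hω2 v hv) (hc2 v hv)
    nlinarith
  have h3 := mul_le_mul_of_nonneg_left hJ hμ₁
  have h4 := mul_le_mul_of_nonneg_left hN hμ₂
  linarith

/-- **The out-defect factor against the emission budget.**  With `ϖ = Φu₀ − m(1−Φ)`, `u₀ ≥ S·γ·U` (suffix decomposition of the
A-channel at depth `j`, `U = u_{j+1}`), `K₄ = (Φ+m)(1−Φ)` and the budget `N′ + K₄ = aΦSU`: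
`ϖ·a·(Φ+m) ≥ γ(Φ+m)·N′ + (γ(Φ+m) − a·m)·K₄`, i.e. `ϖ ≥ (γ/a)N′ + (γ/a − m/(Φ+m))K₄`.
[cite: KozmaNitzan2024, Question 8 (§5.5 p. 36)] -/
theorem kUC_varpi (ϖ Φ m u₀ S γ U a K₄ N' : ℝ) (hΦ : 0 ≤ Φ) (ha : 0 ≤ a) (hΦm : 0 ≤ Φ + m)
    (hϖ : ϖ = Φ * u₀ - m * (1 - Φ)) (hu₀ : S * γ * U ≤ u₀) (hK : K₄ = (Φ + m) * (1 - Φ))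
    (hN : N' + K₄ = a * Φ * S * U) :
    γ * (Φ + m) * N' + (γ * (Φ + m) - a * m) * K₄ ≤ ϖ * a * (Φ + m) := by
  have h1 : Φ * (S * γ * U) ≤ Φ * u₀ := mul_le_mul_of_nonneg_left hu₀ hΦ
  -- ϖ a (Φ+m) = a(Φ+m)Φ u₀ − a m (Φ+m)(1−Φ) ≥ a(Φ+m) Φ S γ U − a m K₄ = (Φ+m) γ (N'+K₄) − a m K₄
  have e1 : ϖ * a * (Φ + m) = a * (Φ + m) * (Φ * u₀) - a * m * K₄ := by rw [hϖ, hK]; ring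
  have e2 : γ * (Φ + m) * N' + (γ * (Φ + m) - a * m) * K₄ = (Φ + m) * γ * (a * Φ * S * U) - a * m * K₄ := by
    rw [← hN]; ring
  rw [e1, e2]
  have : (Φ + m) * γ * (a * Φ * S * U) = a * (Φ + m) * (Φ * (S * γ * U)) := by ring
  rw [this]
  have := mul_le_mul_of_nonneg_left h1 (mul_nonneg ha hΦm)
  linarith

/-- **AM–GM core of the BUDGET LEMMA.**  For `α, β > 0`, `0 ≤ σ` with `σ² ≤ αβ` and `N′, K ≥ 0`:
`(α + β + 2σ)·N′K ≤ (N′ + K)(αN′ + βK)`; with `σ = √(αβ)` this is `N′K/(αN′+βK) ≤ (N′+K)/(√α+√β)²`.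
[cite: KozmaNitzan2024, Question 8 (§5.5 p. 36)] -/
theorem kUC_amgm (α β σ N K : ℝ) (hα : 0 ≤ α) (hβ : 0 ≤ β) (hσ : 0 ≤ σ) (hσ2 : σ ^ 2 ≤ α * β)
    (hN : 0 ≤ N) (hK : 0 ≤ K) :
    (α + β + 2 * σ) * (N * K) ≤ (N + K) * (α * N + β * K) := by
  -- (N+K)(αN+βK) − (α+β)NK = αN² + βK² ≥ 2σNK
  have key : 2 * σ * (N * K) ≤ α * N ^ 2 + β * K ^ 2 := by
    -- (αN² + βK²)² ≥ 4αβN²K² ≥ 4σ²N²K², both sides nonneg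
    have h1 : 0 ≤ α * N ^ 2 + β * K ^ 2 := by positivity
    have h2 : (2 * σ * (N * K)) ^ 2 ≤ (α * N ^ 2 + β * K ^ 2) ^ 2 := by
      have h3 : (2 * σ * (N * K)) ^ 2 = 4 * σ ^ 2 * (N ^ 2 * K ^ 2) := by ring
      have h4 : 4 * (α * β) * (N ^ 2 * K ^ 2) ≤ (α * N ^ 2 + β * K ^ 2) ^ 2 := by
        nlinarith [sq_nonneg (α * N ^ 2 - β * K ^ 2)]
      have h5 : 4 * σ ^ 2 * (N ^ 2 * K ^ 2) ≤ 4 * (α * β) * (N ^ 2 * K ^ 2) := by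
        have : 0 ≤ N ^ 2 * K ^ 2 := by positivity
        nlinarith
      rw [h3]; linarith
    have h6 : 0 ≤ 2 * σ * (N * K) := by positivity
    exact (pow_le_pow_iff_left₀ h6 h1 (by norm_num : (2:ℕ) ≠ 0)).mp h2
  nlinarith

/-- **BUDGET LEMMA, one positive depth.**  Chain (1) `e·p ≤ (1−s)·v·a·N′`, the out-defect `c·Φ ≥ S·a·γ·v·ϖ` (i.e. `cΦ = Dϖ`,
`D ≥ Saγv`), `ϖ ≥ αN′ + βK` and the AM–GM bound `N′K ≤ M(N′+K)(αN′+βK)` with the budget `N′ + K = aΦSU` give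
`e·K·p·γ ≤ c·(1−s)·Φ²·a·M·U`  (so `Q₊·K₄/((Φ+m)c) ≤ xΦ·Σ_j (1−s_{j+1})θ_jM_ju_{j+1}/p_j`).
[cite: KozmaNitzan2024, Question 8 (§5.5 p. 36)] -/
theorem kUC_budget_term (e p s v a N' c Φ S γ ϖ α β K M U : ℝ)
    (hs : s ≤ 1) (hv : 0 ≤ v) (ha : 0 ≤ a) (hΦ : 0 < Φ) (hS : 0 ≤ S) (hγ : 0 ≤ γ) (hK : 0 ≤ K)
    (hM : 0 ≤ M) (hU : 0 ≤ U)
    (he : e * p ≤ (1 - s) * v * a * N') (hc : S * a * γ * v * ϖ ≤ c * Φ) (hϖ : α * N' + β * K ≤ ϖ)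
    (hAM : N' * K ≤ M * (N' + K) * (α * N' + β * K)) (hbud : N' + K = a * Φ * S * U) :
    e * K * p * γ ≤ c * (1 - s) * Φ ^ 2 * a * M * U := by
  have hs0 : 0 ≤ 1 - s := by linarith
  -- step 1: e K p ≤ (1-s) v a N' K ≤ (1-s) v a M (N'+K)(αN'+βK)
  have h1 : e * K * p ≤ (1 - s) * v * a * (N' * K) := by nlinarith [mul_le_mul_of_nonneg_right he hK]
  have h2 : (1 - s) * v * a * (N' * K) ≤ (1 - s) * v * a * (M * (N' + K) * (α * N' + β * K)) :=
    mul_le_mul_of_nonneg_left hAM (by positivity)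
  -- step 2: S a γ v (αN'+βK) ≤ S a γ v ϖ ≤ c Φ
  have h3 : S * a * γ * v * (α * N' + β * K) ≤ c * Φ := by
    have := mul_le_mul_of_nonneg_left hϖ (show 0 ≤ S * a * γ * v by positivity)
    linarith
  -- combine: e K p γ ≤ (1-s) v a M (N'+K) (αN'+βK) γ = (1-s) M (aΦSU) · [S a γ v (αN'+βK)] / S ... use hbud
  have h4 : e * K * p * γ ≤ (1 - s) * v * a * (M * (N' + K) * (α * N' + β * K)) * γ := by
    have := le_trans h1 h2
    exact mul_le_mul_of_nonneg_right this hγ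
  rw [hbud] at h4
  -- (1-s) v a M (aΦSU)(αN'+βK) γ = (1-s) M Φ U a · [S a γ v (αN'+βK)]
  have e5 : (1 - s) * v * a * (M * (a * Φ * S * U) * (α * N' + β * K)) * γ
      = ((1 - s) * M * Φ * U * a) * (S * a * γ * v * (α * N' + β * K)) := by ring
  rw [e5] at h4
  have h6 : ((1 - s) * M * Φ * U * a) * (S * a * γ * v * (α * N' + β * K))
      ≤ ((1 - s) * M * Φ * U * a) * (c * Φ) :=
    mul_le_mul_of_nonneg_left h3 (by positivity)
  have e7 : ((1 - s) * M * Φ * U * a) * (c * Φ) = c * (1 - s) * Φ ^ 2 * a * M * U := by ring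
  linarith [h4, h6, e7]

/-- **The `Q₊²/c` scale of the kill route, one positive depth.**  Chain (1) `e·p ≤ (1−s)vaN′`, `c·Φ ≥ S·γ²·v·N′` (from
`ϖ ≥ (γ/a)N′`), `N′ ≤ aΦSU` and the shallow channel `v ≤ a²xSm″` give `e²p²γ² ≤ c·(1−s)²·x·S·a⁵Φ²·m″·U`.
[cite: KozmaNitzan2024, Question 8 (§5.5 p. 36)] -/
theorem kUC_q2_term (e p s v a N' c Φ S γ x m U : ℝ)
    (hp : 0 < p) (hs : s ≤ 1) (hv : 0 ≤ v) (hS : 0 ≤ S) (hN0 : 0 ≤ N')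
    (hx : 0 ≤ x) (hm : 0 ≤ m) (he0 : 0 ≤ e) (he : e * p ≤ (1 - s) * v * a * N') (hc : S * γ ^ 2 * v * N' ≤ c * Φ)
    (hN : N' ≤ a * Φ * S * U) (hsh : v ≤ a ^ 2 * x * S * m) :
    e ^ 2 * p ^ 2 * γ ^ 2 ≤ c * (1 - s) ^ 2 * x * S * a ^ 5 * Φ ^ 2 * m * U := by
  have hs0 : 0 ≤ 1 - s := by linarith
  have hep : 0 ≤ e * p := by positivity
  -- e²p² ≤ ((1-s) v a N')² = (1-s)² v a² N' · (v N') ... ≤ (1-s)² a² · v N' · (v' N'')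
  have h1 : e ^ 2 * p ^ 2 ≤ ((1 - s) * v * a * N') ^ 2 := by
    have := mul_le_mul he he hep (by linarith)
    nlinarith
  -- ((1-s) v a N')² γ² = (1-s)² a² v N' · [γ² v N'] ≤ (1-s)² a² v N' · cΦ/S ... avoid division: multiply target by S? use S γ² v N' ≤ cΦ
  -- target: e²p²γ² ≤ c (1-s)² x S a⁵ Φ² m U.  We show ((1-s) v a N')² γ² ≤ c (1-s)² x S a⁵ Φ² m U.
  have h2 : ((1 - s) * v * a * N') ^ 2 * γ ^ 2 = ((1 - s) ^ 2 * a ^ 2 * (v * N')) * (γ ^ 2 * v * N') := by ring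
  have h3 : ((1 - s) ^ 2 * a ^ 2 * (v * N')) * (S * γ ^ 2 * v * N') ≤ ((1 - s) ^ 2 * a ^ 2 * (v * N')) * (c * Φ) :=
    mul_le_mul_of_nonneg_left hc (by positivity)
  -- and v N' ≤ (a² x S m)(a Φ S U)
  have h4 : v * N' ≤ (a ^ 2 * x * S * m) * (a * Φ * S * U) := mul_le_mul hsh hN hN0 (by positivity)
  -- combine: e²p²γ² S ≤ (1-s)² a² (vN') cΦ ≤ (1-s)² a² (a²xSm)(aΦSU) cΦ = c (1-s)² x S a⁵ Φ² m U · S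
  have h5 : e ^ 2 * p ^ 2 * γ ^ 2 * S ≤ ((1 - s) ^ 2 * a ^ 2 * (v * N')) * (c * Φ) := by
    have h1' := mul_le_mul_of_nonneg_right h1 (sq_nonneg γ)
    have : ((1 - s) * v * a * N') ^ 2 * γ ^ 2 * S = ((1 - s) ^ 2 * a ^ 2 * (v * N')) * (S * γ ^ 2 * v * N') := by ring
    nlinarith [h3, this, h1']
  have hcΦ : 0 ≤ c * Φ := le_trans (by positivity) hc
  have h6 : ((1 - s) ^ 2 * a ^ 2 * (v * N')) * (c * Φ) ≤ ((1 - s) ^ 2 * a ^ 2 * ((a ^ 2 * x * S * m) * (a * Φ * S * U))) * (c * Φ) := by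
    apply mul_le_mul_of_nonneg_right _ hcΦ
    apply mul_le_mul_of_nonneg_left h4 (by positivity)
  have e8 : ((1 - s) ^ 2 * a ^ 2 * ((a ^ 2 * x * S * m) * (a * Φ * S * U))) * (c * Φ)
      = (c * (1 - s) ^ 2 * x * S * a ^ 5 * Φ ^ 2 * m * U) * S := by ring
  by_cases hS0 : S = 0
  · -- then N' ≤ 0 so N' = 0, e p ≤ 0, e = 0
    have : N' ≤ 0 := by rw [hS0] at hN; simpa using hN
    have hN1 : N' = 0 := le_antisymm this hN0
    have : e * p ≤ 0 := by rw [hN1] at he; simpa using he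
    have he1 : e = 0 := by nlinarith
    rw [he1, hS0]; simp
  · have hSpos : 0 < S := lt_of_le_of_ne hS (Ne.symm hS0)
    have := le_trans h5 (le_trans h6 (le_of_eq e8))
    exact le_of_mul_le_mul_right this hSpos

/-- **R-kill lower bound at a non-positive depth.**  `Ũ = uL̃ + vR̃ − Γuv` with `L̃ ≥ 0`, `u, v ≥ 0`, `R̃ ≥ γκ₀` where
`κ₀ = (1−a)(K₃−H) + aK₄` and `Γ = γa²ΦS`: then `Ũ ≥ v·γ·((1−a)(K₃−H) + aK₄ − a²ΦS u)`, and since also `Ũ ≥ 0` at a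
non-positive depth, `Ũ ≥ v·γ·max(κ, 0)`.
[cite: KozmaNitzan2024, Question 8 (§5.5 p. 36)] -/
theorem kUC_kill (Ut u v Lt Rt γ a Φ S K₃ K₄ H : ℝ) (hu : 0 ≤ u) (hv : 0 ≤ v) (hL : 0 ≤ Lt)
    (hU : Ut = u * Lt + v * Rt - γ * a ^ 2 * Φ * S * u * v) (hR : γ * ((1 - a) * (K₃ - H) + a * K₄) ≤ Rt)
    (hU0 : 0 ≤ Ut) :
    v * γ * max ((1 - a) * (K₃ - H) + a * K₄ - a ^ 2 * Φ * S * u) 0 ≤ Ut := by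
  rcases le_or_gt ((1 - a) * (K₃ - H) + a * K₄ - a ^ 2 * Φ * S * u) 0 with h | h
  · rw [max_eq_right h]; simpa using hU0
  · rw [max_eq_left h.le, hU]
    have h1 : v * (γ * ((1 - a) * (K₃ - H) + a * K₄)) ≤ v * Rt := mul_le_mul_of_nonneg_left hR hv
    nlinarith [mul_nonneg hu hL]

end PocketCert

end Summit.CriticalPhenomena.PercolationContinuityZ3.Theorems
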